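import Literature.Analysis.FluidPDE.HardSphereCollisionRecord
import Literature.MathematicalPhysics.KineticTheory.HardSphereEuler
import HarnessLib

/-!
# Objects and stub statements of the line `pedigree-perpetuity`
# (crux `EnergyCurrentTails`, stmt-AtomisticToContinuum-9235)

Definitions-only support file (`--supports stmt-AtomisticToContinuum-9235`) of the line lead
(seat c3, `prover-line-stmt-AtomisticToContinuum-9235-c3-0`; skeleton
`Cruxes/EnergyCurrentTails/Lines/pedigree_perpetuity.lean`, planner
`planner-cruxplan-stmt-AtomisticToContinuum-9235-pedigree-perpetuity-0`).  It makes the line's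
VOCABULARY importable so that each registered stub can land in its own sorry-free Theorems file with
the registered signature verbatim (`theorem stub_lineageLedgerSure : LineageLedgerSure`, …).  §1–§2
(the backward energy lineage and the expected level census) are copied byte-for-byte from the
skeleton; §3 names the statements of the line as `Prop`s.  NOTHING IS ASSERTED here: the crux decl
stays in the route files (`…Theses.WarmColdDichotomy.EnergyCurrentTails`, primary;
`…Theses.OneFlightGossipEngine.EnergyCurrentTails`, byte-identical copy), the composition
`LineageLedger → LevelInclusion → InitialEnergyTails → NeutralRunTails → MergeIntakeTails → CensusDecay
→ crux` stays in the skeleton, and no `Prop` below restates, specialises or strengthens the crux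
(`CensusDecay` is the line's TRANSFER statement C⁺ — a fourth-order level-census bound, strictly
stronger one-time information; the ledger / inclusion statements are sure kinematics of the flow;
`InitialEnergyTails` is about the data at `t = 0`; `NeutralRunTails` / `MergeIntakeTails` are
annealed statistics of ONE tagged backward lineage).

## The line in one paragraph

Follow the ENERGY LINEAGE of a particle `i` backwards from time `s`: at each collision go to the
PROJECTILE (the incoming particle with the larger pre-collisional energy).  Along the lineage the
carried energies obey the packet step `E_n ≤ s_n·E_{n+1} + q_n` (`s_n ∈ [0,1]` the followed branch's
share of the projectile energy — a good = δ-splitting step has `s_n ≤ 1 − δ`, BOTH δ-neutral ends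
(graze, dead-centre hop) have `s_n > 1 − δ`; `q_n` the partner's pre-energy), hence the backward
PERPETUITY `E_0 ≤ Σ_n q̃_n w_n + E_K w_K`, `w_n = Π_{j<n} s_j ≤ (1−δ)^{#good steps before n}`.  Being at
level `L·Θ₀` now forces one of: a long recent δ-NEUTRAL BLOCK (priced by `NeutralRunTails`), a large
DISCOUNTED WARM INTAKE (priced by `MergeIntakeTails`), a large discounted INHERITANCE from time `0`
(heir cascade of the ledger + Gaussian data), or a huge total energy (Gaussian data + conservation):
`LevelInclusion` (sure) and then `CensusDecay` (expected level census `≤ B(N+1)L⁻⁴`), which docks to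
the crux by binning the cubic tail over levels (file `…PedigreeDocking`).

## Reshape by the lead (seat c3) relative to the planner's skeleton

* the planner's `LineageLedger` is split into `LineageLedgerSure` (clauses K0/K/C, with two added
  sure clauses: shares in `[0,1]` for EVERY index, and `E_n ≤` total kinetic energy of the datum) and
  `LineageMeasurable` (clause M, with the a.e.-measurability of the terminal carrier / weight added);
  `LineageLedger := LineageLedgerSure ∧ LineageMeasurable`;
* the planner's `stub_censusAssembly` is split into the sure `LevelInclusion` (new named statement,
  registered as `stub_levelInclusion : LineageLedgerSure → LevelInclusion`) and the probabilistic
  assembly `stub_censusAssembly : LineageLedger → LevelInclusion → InitialEnergyTails →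
  NeutralRunTails → MergeIntakeTails → CensusDecay`.

Registered stubs of the line (by `ledger workitem stub-add`, additive): `stub_lineageLedgerSure`,
`stub_lineageMeasurable`, `stub_levelInclusion`, `stub_initialEnergyTails`, `stub_neutralRunTails`
(hardest, lead), `stub_mergeIntakeTails`, `stub_censusAssembly`; `stub_censusDocking :
CensusDecay → WarmColdDichotomy.EnergyCurrentTails` is closed (file `…PedigreeDocking`).

References: Gallagher–Saint-Raymond–Texier 2013 §4.1 (collision records, flights);
Cercignani–Illner–Pulvirenti 1994 §4.2; the perpetuity/discounting bookkeeping is elementary.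
-/

noncomputable section

open MeasureTheory Set Filter
open scoped ENNReal InnerProductSpace BigOperators

namespace Summit.AtomisticToContinuum.HydrodynamicLimit.Theorems.EnergyCurrentTailsPedigree

open Literature.MathematicalPhysics.KineticTheory Literature.Analysis.FluidPDE

/-! ## §1 The backward energy lineage (definitions; junk values off the good set are harmless) -/

section Lineage

variable {N : ℕ} (ε : ℝ) (γ : ℝ → Config N (Fin 3) T3)

/-- One backward step from the state `(carrier, time)`: go to the start `b` of the carrier's current
flight (`flightStart` from time `0`; `b = 0` if the carrier has no collision in `(0, time)`), read the
collision record there (partner = `partner`, pre-velocities by `HardSphereCollisionRecord.ofConfig`)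
and move to the PROJECTILE — the incoming particle with the larger pre-collisional speed (ties: stay). -/
def stepBack (x : Fin N × ℝ) : Fin N × ℝ :=
  (if ‖(HardSphereCollisionRecord.ofConfig (Torus.geometry (Fin 3)) ε
          (γ (flightStart (Torus.geometry (Fin 3)) ε γ 0 x.1 x.2))
          (flightStart (Torus.geometry (Fin 3)) ε γ 0 x.1 x.2) x.1
          (partner (Torus.geometry (Fin 3)) ε
            (γ (flightStart (Torus.geometry (Fin 3)) ε γ 0 x.1 x.2)) x.1)).preVel.2‖
        ≤ ‖(HardSphereCollisionRecord.ofConfig (Torus.geometry (Fin 3)) ε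
          (γ (flightStart (Torus.geometry (Fin 3)) ε γ 0 x.1 x.2))
          (flightStart (Torus.geometry (Fin 3)) ε γ 0 x.1 x.2) x.1
          (partner (Torus.geometry (Fin 3)) ε
            (γ (flightStart (Torus.geometry (Fin 3)) ε γ 0 x.1 x.2)) x.1)).preVel.1‖
    then x.1
    else partner (Torus.geometry (Fin 3)) ε (γ (flightStart (Torus.geometry (Fin 3)) ε γ 0 x.1 x.2)) x.1,
   flightStart (Torus.geometry (Fin 3)) ε γ 0 x.1 x.2)

/-- **The backward energy lineage** of particle `i` from time `s`: state `n` = (carrier `c_n`, time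
`τ_n`), `(c₀, τ₀) = (i, s)`; the transition `n ↦ n+1` is the collision at `τ_{n+1}` (the start of
`c_n`'s flight current before `τ_n`), whose projectile is `c_{n+1}`. -/
def lineage (i : Fin N) (s : ℝ) : ℕ → Fin N × ℝ
  | 0 => (i, s)
  | n + 1 => stepBack ε γ (lineage i s n)

/-- Carrier `c_n` of state `n`. -/
def carrier (i : Fin N) (s : ℝ) (n : ℕ) : Fin N := (lineage ε γ i s n).1

/-- Time `τ_n` of state `n` (`τ₀ = s`; `τ_{n+1} = flightStart … (c_n) (τ_n)`). -/
def ltime (i : Fin N) (s : ℝ) (n : ℕ) : ℝ := (lineage ε γ i s n).2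

/-- The collision record BEHIND state `n`: the record at time `τ_{n+1}` of the ordered pair
`(c_n, partner of c_n)` (post-velocities = the configuration at `τ_{n+1}`, pre-velocities by
reflection, impact vector `ε⁻¹ • sepVec`). -/
def brecord (i : Fin N) (s : ℝ) (n : ℕ) : HardSphereCollisionRecord (Fin 3) T3 N :=
  HardSphereCollisionRecord.ofConfig (Torus.geometry (Fin 3)) ε (γ (ltime ε γ i s (n + 1)))
    (ltime ε γ i s (n + 1)) (carrier ε γ i s n)
    (partner (Torus.geometry (Fin 3)) ε (γ (ltime ε γ i s (n + 1))) (carrier ε γ i s n))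

/-- The transition `n ↦ n+1` is a GENUINE collision iff it happens at a positive time (otherwise the
lineage has reached the data: `τ_{n+1} = 0`). -/
def Genuine (i : Fin N) (s : ℝ) (n : ℕ) : Prop := 0 < ltime ε γ i s (n + 1)

/-- Carried energy `E_n` of state `n`: the kinetic energy `‖v‖²` (no factor ½) of `c_n` on its flight
current before `τ_n`, i.e. `‖(γ τ_{n+1} c_n).2‖²` (post-collisional value at the flight start). -/
def energy (i : Fin N) (s : ℝ) (n : ℕ) : ℝ := ‖(brecord ε γ i s n).postVel.1‖ ^ 2

/-- Projectile pre-energy of the transition `n ↦ n+1` (`= E_{n+1}` on good trajectories). -/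
def projEnergy (i : Fin N) (s : ℝ) (n : ℕ) : ℝ :=
  max (‖(brecord ε γ i s n).preVel.1‖ ^ 2) (‖(brecord ε γ i s n).preVel.2‖ ^ 2)

/-- Partner pre-energy (the quantum `q_n`) of the transition `n ↦ n+1`. -/
def quantum (i : Fin N) (s : ℝ) (n : ℕ) : ℝ :=
  min (‖(brecord ε γ i s n).preVel.1‖ ^ 2) (‖(brecord ε γ i s n).preVel.2‖ ^ 2)

/-- The followed branch's SHARE `s_n ∈ [0,1]` of the projectile energy: `1 − cos²(v̂_proj, ω)` if the
carrier `c_n` was the projectile (it continued through the collision), `cos²(v̂_proj, ω)` if it was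
the target. -/
def share (i : Fin N) (s : ℝ) (n : ℕ) : ℝ :=
  if ‖(brecord ε γ i s n).preVel.2‖ ≤ ‖(brecord ε γ i s n).preVel.1‖ then
    1 - ⟪(brecord ε γ i s n).preVel.1, (brecord ε γ i s n).impactVec⟫_ℝ ^ 2
          / ‖(brecord ε γ i s n).preVel.1‖ ^ 2
  else ⟪(brecord ε γ i s n).preVel.2, (brecord ε γ i s n).impactVec⟫_ℝ ^ 2
          / ‖(brecord ε γ i s n).preVel.2‖ ^ 2

/-- Discount weight `w_n = Π_{j<n} s_j` of the transition `n ↦ n+1`. -/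
def weight (i : Fin N) (s : ℝ) (n : ℕ) : ℝ := ∏ j ∈ Finset.range n, share ε γ i s j

/-- The LIFT `λ_n = (E_n − s_n·E^{proj}_n − Θ₀)₊`: the part of the effective quantum above the thermal
threshold `Θ₀` (a positive lift needs an energetic partner AND an energetic projectile). -/
def lift (Θ₀ : ℝ) (i : Fin N) (s : ℝ) (n : ℕ) : ℝ :=
  max (energy ε γ i s n - share ε γ i s n * projEnergy ε γ i s n - Θ₀) 0

open scoped Classical in
/-- **Discounted warm intake** `Λ = Σ_{genuine n} λ_n w_n` (a finite sum on good trajectories). -/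
def warmIntake (Θ₀ : ℝ) (i : Fin N) (s : ℝ) : ℝ :=
  ∑' n : ℕ, if Genuine ε γ i s n then lift ε γ Θ₀ i s n * weight ε γ i s n else 0

/-- Good (= δ-SPLITTING for the followed branch) transition: share at most `1 − δ`.  Its negation is the
TWO-SIDED δ-neutral set (graze with the projectile followed, or dead-centre hop with the target followed). -/
def Good (δ : ℝ) (i : Fin N) (s : ℝ) (n : ℕ) : Prop := share ε γ i s n ≤ 1 - δ

open scoped Classical in
/-- Number of good transitions before `n`. -/
def goodCount (δ : ℝ) (i : Fin N) (s : ℝ) (n : ℕ) : ℕ :=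
  ((Finset.range n).filter fun j => Good ε γ δ i s j).card

/-- **Block `g`**: the genuine transitions with exactly `g` good transitions before them (a run of
δ-neutral transitions closed by one good transition, counting backwards from time `s`). -/
def block (δ : ℝ) (i : Fin N) (s : ℝ) (g : ℕ) : Set ℕ :=
  {n | Genuine ε γ i s n ∧ goodCount ε γ δ i s n = g}

/-- **Energetic prefix length of block `g`** above the level `Θe`: the number of members of block `g`
all of whose block-predecessors (themselves included) have projectile pre-energy `≥ Θe` (in `ℕ∞`). -/
def eblockLen (Θe δ : ℝ) (i : Fin N) (s : ℝ) (g : ℕ) : ℕ∞ :=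
  Set.encard {n | n ∈ block ε γ δ i s g ∧
    ∀ n', n' ∈ block ε γ δ i s g → n' ≤ n → Θe ≤ projEnergy ε γ i s n'}

/-- Terminal index `K*`: the first non-genuine transition (the lineage has reached the data). -/
def termIndex (i : Fin N) (s : ℝ) : ℕ := sInf {n | ¬ Genuine ε γ i s n}

/-- Terminal carrier (the SEED at time `0`). -/
def termCarrier (i : Fin N) (s : ℝ) : Fin N := carrier ε γ i s (termIndex ε γ i s)

/-- Terminal discount weight `w_{K*}`. -/
def termWeight (i : Fin N) (s : ℝ) : ℝ := weight ε γ i s (termIndex ε γ i s)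

end Lineage

/-! ## §2 The expected level census -/

/-- Expected LEVEL CENSUS at time `s`: `E_{λ_N} #{l : x ≤ ‖v_l(s)‖²}` (an extended nonnegative real). -/
def census (σ : ℝ) (a₀ θ₀ : T3 → ℝ) (u₀ : T3 → V3) (N : ℕ)
    (Φ : HardSphereFlow (Torus.geometry (Fin 3)) (hsDiameter σ N) (N + 1)) (s x : ℝ) : ℝ≥0∞ :=
  ∫⁻ z, (∑ l : Fin (N + 1),
      Set.indicator {v : V3 | x ≤ ‖v‖ ^ 2} (fun _ => (1 : ℝ≥0∞)) ((Φ.flow s z l).2))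
    ∂(localGibbsLaw σ a₀ u₀ θ₀ N Φ)

/-! ## §3 The named statements of the line -/

/-- **TRANSFER STATEMENT `C⁺` — CENSUS DECAY.**  In the frame of the crux: for every `t < T` there are
a level scale `Θ > 0`, a constant `B` and `N₀` such that for `N ≥ N₀`, `s ∈ [0,t]` and every level
`L ≥ 1` the expected number of particles with `‖v‖² ≥ L·Θ` is at most `B (N+1) / L⁴`. -/
def CensusDecay : Prop :=
  ∀ (a₀ θ₀ : T3 → ℝ) (u₀ : T3 → V3), Continuous a₀ → Continuous θ₀ → Continuous u₀ →
    (∀ x, 0 < a₀ x) → (∀ x, 0 < θ₀ x) → ∃ σ₀ : ℝ, 0 < σ₀ ∧ ∀ σ : ℝ, 0 < σ → σ < σ₀ →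
    ∀ (T : ℝ) (ρ θ : ℝ → T3 → ℝ) (u : ℝ → T3 → V3), IsHardSphereEulerSolution σ T ρ u θ →
    ∀ Φ : (N : ℕ) → HardSphereFlow (Torus.geometry (Fin 3)) (hsDiameter σ N) (N + 1),
      TendstoHydroFieldsAt (fun N => localGibbsLaw σ a₀ u₀ θ₀ N (Φ N)) Φ ρ u θ 0 →
      ∀ t ∈ Set.Ico 0 T, ∃ Θ : ℝ, 0 < Θ ∧ ∃ B : ℝ, ∃ N₀ : ℕ, ∀ N : ℕ, N₀ ≤ N → ∀ s ∈ Set.Icc 0 t,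
        ∀ L : ℕ, 1 ≤ L →
          census σ a₀ θ₀ u₀ N (Φ N) s (L * Θ) ≤ ENNReal.ofReal (B * ((N : ℝ) + 1) / (L : ℝ) ^ 4)

/-- **LINEAGE LEDGER, SURE PART (on the good set).**  For every flow, every good initial datum `z`
(trajectory `γ = Φ.flow · z`), particle `i` and time `s > 0`:
(K0) every share lies in `[0,1]` (all `n`, genuine or not);
(K) kinematics of every genuine transition `n` — packet step `E_n ≤ s_n E^{proj}_n + q_n`, pair
bound `E_n ≤ E^{proj}_n + q_n`, identification `E_{n+1} = E^{proj}_n`, time decrease `τ_{n+1} < τ_n`;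
times: `0 ≤ τ_{n+1}`; genuineness is downward closed and fails eventually; the terminal energy is the
seed's DATA energy `E_{K*} = ‖(z c_{K*}).2‖²`; if `i` is not in a collision at time `s` then
`E_0 = ‖v_i(s)‖²`; every carried energy is at most the (conserved) total kinetic energy of the datum;
(C) HEIR CASCADE: for every seed `j`, the terminal weights of the particles whose lineage ends at `j`
sum to at most `1` (the shares of the two branches of a collision are complementary). -/
def LineageLedgerSure : Prop :=
  ∀ (σ : ℝ) (N : ℕ) (Φ : HardSphereFlow (Torus.geometry (Fin 3)) (hsDiameter σ N) (N + 1)),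
    (∀ z ∈ Φ.good, ∀ (i : Fin (N + 1)) (s : ℝ), 0 < s →
      (∀ n, 0 ≤ share (hsDiameter σ N) (fun r => Φ.flow r z) i s n
          ∧ share (hsDiameter σ N) (fun r => Φ.flow r z) i s n ≤ 1)
      ∧ (∀ n, Genuine (hsDiameter σ N) (fun r => Φ.flow r z) i s n →
          energy (hsDiameter σ N) (fun r => Φ.flow r z) i s n
              ≤ share (hsDiameter σ N) (fun r => Φ.flow r z) i s n
                  * projEnergy (hsDiameter σ N) (fun r => Φ.flow r z) i s n
                + quantum (hsDiameter σ N) (fun r => Φ.flow r z) i s n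
          ∧ energy (hsDiameter σ N) (fun r => Φ.flow r z) i s n
              ≤ projEnergy (hsDiameter σ N) (fun r => Φ.flow r z) i s n
                + quantum (hsDiameter σ N) (fun r => Φ.flow r z) i s n
          ∧ energy (hsDiameter σ N) (fun r => Φ.flow r z) i s (n + 1)
              = projEnergy (hsDiameter σ N) (fun r => Φ.flow r z) i s n
          ∧ ltime (hsDiameter σ N) (fun r => Φ.flow r z) i s (n + 1)
              < ltime (hsDiameter σ N) (fun r => Φ.flow r z) i s n)
      ∧ (∀ n, 0 ≤ ltime (hsDiameter σ N) (fun r => Φ.flow r z) i s (n + 1))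
      ∧ (∀ n, Genuine (hsDiameter σ N) (fun r => Φ.flow r z) i s (n + 1) →
          Genuine (hsDiameter σ N) (fun r => Φ.flow r z) i s n)
      ∧ (∃ K, ¬ Genuine (hsDiameter σ N) (fun r => Φ.flow r z) i s K)
      ∧ energy (hsDiameter σ N) (fun r => Φ.flow r z) i s
            (termIndex (hsDiameter σ N) (fun r => Φ.flow r z) i s)
          = ‖(z (termCarrier (hsDiameter σ N) (fun r => Φ.flow r z) i s)).2‖ ^ 2
      ∧ (¬ Participates (Torus.geometry (Fin 3)) (hsDiameter σ N) (Φ.flow s z) i →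
          energy (hsDiameter σ N) (fun r => Φ.flow r z) i s 0 = ‖(Φ.flow s z i).2‖ ^ 2)
      ∧ (∀ n, energy (hsDiameter σ N) (fun r => Φ.flow r z) i s n ≤ ∑ l : Fin (N + 1), ‖(z l).2‖ ^ 2))
    ∧ (∀ z ∈ Φ.good, ∀ (s : ℝ), 0 < s → ∀ j : Fin (N + 1),
        (∑ i ∈ (Finset.univ.filter fun i : Fin (N + 1) =>
            termCarrier (hsDiameter σ N) (fun r => Φ.flow r z) i s = j),
          termWeight (hsDiameter σ N) (fun r => Φ.flow r z) i s) ≤ 1)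

/-- **LINEAGE LEDGER, MEASURABLE PART.**  Liouville-a.e. measurability in `z` of the lineage data
(times, carriers, record velocities, impact vectors) for every flow of the crux frame, particle `i`,
time `s` and index `n` (`Measurable` on the good set — the flow is junk off it, so only the a.e. form
is a fact; `flightStart` is a countable supremum of the measurable `HardSphereFlow.nthCollisionTimeOf`). -/
def LineageMeasurable : Prop :=
  ∀ (σ : ℝ) (N : ℕ) (Φ : HardSphereFlow (Torus.geometry (Fin 3)) (hsDiameter σ N) (N + 1))
    (i : Fin (N + 1)) (s : ℝ),
    (∀ n : ℕ,
      AEMeasurable (fun z => ltime (hsDiameter σ N) (fun r => Φ.flow r z) i s n)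
        (liouville (Torus.geometry (Fin 3)) (N + 1) (hsDiameter σ N))
      ∧ AEMeasurable (fun z => carrier (hsDiameter σ N) (fun r => Φ.flow r z) i s n)
        (liouville (Torus.geometry (Fin 3)) (N + 1) (hsDiameter σ N))
      ∧ AEMeasurable (fun z => (brecord (hsDiameter σ N) (fun r => Φ.flow r z) i s n).preVel)
        (liouville (Torus.geometry (Fin 3)) (N + 1) (hsDiameter σ N))
      ∧ AEMeasurable (fun z => (brecord (hsDiameter σ N) (fun r => Φ.flow r z) i s n).postVel)
        (liouville (Torus.geometry (Fin 3)) (N + 1) (hsDiameter σ N))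
      ∧ AEMeasurable (fun z => (brecord (hsDiameter σ N) (fun r => Φ.flow r z) i s n).impactVec)
        (liouville (Torus.geometry (Fin 3)) (N + 1) (hsDiameter σ N)))
    ∧ AEMeasurable (fun z => termCarrier (hsDiameter σ N) (fun r => Φ.flow r z) i s)
        (liouville (Torus.geometry (Fin 3)) (N + 1) (hsDiameter σ N))
    ∧ AEMeasurable (fun z => termWeight (hsDiameter σ N) (fun r => Φ.flow r z) i s)
        (liouville (Torus.geometry (Fin 3)) (N + 1) (hsDiameter σ N))

/-- **LINEAGE LEDGER** = sure part ∧ measurable part (the line's stub 2, reshaped by the lead into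
the two registered stubs `stub_lineageLedgerSure` / `stub_lineageMeasurable`). -/
def LineageLedger : Prop := LineageLedgerSure ∧ LineageMeasurable

/-- **LEVEL INCLUSION (sure; the deterministic half of the census assembly).**  On the good set, for
`s > 0` and a particle `i` not in a collision at time `s`: with a splitting parameter `δ ∈ (0,1)`, a
thermal threshold `Θ₀ > 0`, an energetic level `Θe`, a level `L`, a run allowance `m` and a block
horizon `g₁` such that the discounted thermal allowance `Θ₀ Σ_{g<g₁} (1−δ)^g (m+g+2)` and `3 Θe` are
at most `L Θ₀ / 3` resp. `L Θ₀`, IF `‖v_i(s)‖² ≥ L Θ₀` THEN (R) some block `g < g₁` of the backward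
lineage of `(i,s)` has an energetic prefix of length `≥ m+g+2`, OR (Λ) the discounted warm intake is
`≥ L Θ₀ / 3`, OR (I) the discounted inheritance `‖(z seed).2‖² · w_{K*}` is `≥ L Θ₀ / 3`, OR (D) the
total kinetic energy of the datum is `≥ (1−δ)^{-g₁} L Θ₀ / 3` (backward perpetuity + allowances). -/
def LevelInclusion : Prop :=
  ∀ (σ : ℝ) (N : ℕ) (Φ : HardSphereFlow (Torus.geometry (Fin 3)) (hsDiameter σ N) (N + 1)),
    ∀ z ∈ Φ.good, ∀ (i : Fin (N + 1)) (s : ℝ), 0 < s →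
    ¬ Participates (Torus.geometry (Fin 3)) (hsDiameter σ N) (Φ.flow s z) i →
    ∀ (δ Θ₀ Θe L : ℝ) (m g₁ : ℕ), 0 < δ → δ < 1 → 0 < Θ₀ →
      Θ₀ * (∑ g ∈ Finset.range g₁, (1 - δ) ^ g * ((m + g + 2 : ℕ) : ℝ)) ≤ L * Θ₀ / 3 →
      3 * Θe ≤ L * Θ₀ →
      L * Θ₀ ≤ ‖(Φ.flow s z i).2‖ ^ 2 →
        (∃ g, g < g₁ ∧ ((m + g + 2 : ℕ) : ℕ∞)
            ≤ eblockLen (hsDiameter σ N) (fun r => Φ.flow r z) Θe δ i s g)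
        ∨ L * Θ₀ / 3 ≤ warmIntake (hsDiameter σ N) (fun r => Φ.flow r z) Θ₀ i s
        ∨ L * Θ₀ / 3 ≤ ‖(z (termCarrier (hsDiameter σ N) (fun r => Φ.flow r z) i s)).2‖ ^ 2
            * termWeight (hsDiameter σ N) (fun r => Φ.flow r z) i s
        ∨ L * Θ₀ / 3 ≤ (1 - δ) ^ g₁ * ∑ l : Fin (N + 1), ‖(z l).2‖ ^ 2

/-- **GAUSSIAN FACTS OF THE DATA (`t = 0`).**  For continuous profiles (`a₀, θ₀ > 0`) there are
`Θ* > 0`, `ē, C ≥ 0` such that for all `σ ∈ (0, 1/2]`, `N`, flows `Φ` and `x ≥ 0`, under the local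
Gibbs law: (0) mean kinetic energy `E Σ_l ‖v_l‖² ≤ ē (N+1)`; (1) tail energy
`E Σ_l ‖v_l‖² 𝟙{x ≤ ‖v_l‖²} ≤ C (N+1) e^{−x/Θ*}`; (2) total-energy large deviations
`P(ē(N+1) + x ≤ Σ_l ‖v_l‖²) ≤ e^{−x/Θ*}`.  (Velocities are independent Gaussians given positions:
`lintegral_localGibbsMeasure`; provable now.) -/
def InitialEnergyTails : Prop :=
  ∀ (a₀ θ₀ : T3 → ℝ) (u₀ : T3 → V3), Continuous a₀ → Continuous θ₀ → Continuous u₀ →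
    (∀ x, 0 < a₀ x) → (∀ x, 0 < θ₀ x) →
    ∃ Θs : ℝ, 0 < Θs ∧ ∃ eb : ℝ, 0 ≤ eb ∧ ∃ C : ℝ, 0 ≤ C ∧
      ∀ σ : ℝ, 0 < σ → σ ≤ 1 / 2 → ∀ (N : ℕ)
        (Φ : HardSphereFlow (Torus.geometry (Fin 3)) (hsDiameter σ N) (N + 1)) (x : ℝ), 0 ≤ x →
        (∫⁻ z, ENNReal.ofReal (∑ l : Fin (N + 1), ‖(z l).2‖ ^ 2) ∂(localGibbsLaw σ a₀ u₀ θ₀ N Φ)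
            ≤ ENNReal.ofReal (eb * ((N : ℝ) + 1)))
        ∧ (∫⁻ z, ENNReal.ofReal (∑ l : Fin (N + 1),
              Set.indicator {v : V3 | x ≤ ‖v‖ ^ 2} (fun v => ‖v‖ ^ 2) ((z l).2))
              ∂(localGibbsLaw σ a₀ u₀ θ₀ N Φ)
            ≤ ENNReal.ofReal (C * ((N : ℝ) + 1) * Real.exp (-x / Θs)))
        ∧ (localGibbsLaw σ a₀ u₀ θ₀ N Φ)
              {z | eb * ((N : ℝ) + 1) + x ≤ ∑ l : Fin (N + 1), ‖(z l).2‖ ^ 2}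
            ≤ ENNReal.ofReal (Real.exp (-x / Θs))

/-- **NEUTRAL-RUN TAILS (crux-strength; the line's chaos input, annealed).**  In the frame of the crux,
for every `t < T` there are `δ ∈ (0,1)`, an energetic level `Θe`, constants `C ≥ 0`, `ρ₁ ∈ [0,1)` and
`N₀` such that for `N ≥ N₀`, `s ∈ [0,t]`, every particle `i`, every block index `g` and every `n`:
the probability that block `g` of the backward lineage of `(i,s)` — a run of δ-NEUTRAL transitions
(followed-branch share `> 1−δ`: graze OR dead-centre hop) closed by one good one — has an energetic
prefix (projectile pre-energies `≥ Θe`) of length `≥ n` is at most `C ρ₁ⁿ`.  Geometric in the run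
length, uniform in the block index (recency is through the lineage, not through time), one-sided, no
σ-algebra: the annealed form of "impact geometry of energetic encounters is not pinned on the
two-sided δ-neutral set" (triage r1-1 §C / r1-3 sharpen). -/
def NeutralRunTails : Prop :=
  ∀ (a₀ θ₀ : T3 → ℝ) (u₀ : T3 → V3), Continuous a₀ → Continuous θ₀ → Continuous u₀ →
    (∀ x, 0 < a₀ x) → (∀ x, 0 < θ₀ x) → ∃ σ₀ : ℝ, 0 < σ₀ ∧ ∀ σ : ℝ, 0 < σ → σ < σ₀ →
    ∀ (T : ℝ) (ρ θ : ℝ → T3 → ℝ) (u : ℝ → T3 → V3), IsHardSphereEulerSolution σ T ρ u θ →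
    ∀ Φ : (N : ℕ) → HardSphereFlow (Torus.geometry (Fin 3)) (hsDiameter σ N) (N + 1),
      TendstoHydroFieldsAt (fun N => localGibbsLaw σ a₀ u₀ θ₀ N (Φ N)) Φ ρ u θ 0 →
      ∀ t ∈ Set.Ico 0 T, ∃ δ : ℝ, 0 < δ ∧ δ < 1 ∧ ∃ Θe : ℝ, ∃ C : ℝ, 0 ≤ C ∧
        ∃ ρ₁ : ℝ, 0 ≤ ρ₁ ∧ ρ₁ < 1 ∧ ∃ N₀ : ℕ, ∀ N : ℕ, N₀ ≤ N → ∀ s ∈ Set.Icc 0 t,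
        ∀ (i : Fin (N + 1)) (g n : ℕ),
          (localGibbsLaw σ a₀ u₀ θ₀ N (Φ N))
              {z | (n : ℕ∞) ≤ eblockLen (hsDiameter σ N) (fun r => (Φ N).flow r z) Θe δ i s g}
            ≤ ENNReal.ofReal (C * ρ₁ ^ n)

/-- **MERGE-INTAKE TAILS (crux-strength; the merge channel in one piece, annealed).**  In the frame of
the crux, for every `t < T` there are a thermal threshold `Θ₀ > 0`, a constant `B₁` and `N₀` such
that for `N ≥ N₀`, `s ∈ [0,t]`, every particle `i` and every `L ≥ 1`: the DISCOUNTED WARM INTAKE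
`Λ = Σ_n λ_n w_n` of the backward lineage of `(i,s)` (lifts `λ_n = (E_n − s_n E^{proj}_n − Θ₀)₊`,
each requiring an energetic partner AND an energetic projectile, discounted by the shares of the
later transitions) satisfies `P(Λ ≥ L·Θ₀) ≤ B₁/L⁵`.  What it prices: two energetic packets meeting
("doubling needs an equal"), summed over the lineage with the perpetuity discount; see the line card
for why this is NOT reducible to an annealed pair bound `A·n(E)²/N` by union bounds (that global
quadratic form is false at `t = 0` for non-constant `θ₀`). -/
def MergeIntakeTails : Prop :=
  ∀ (a₀ θ₀ : T3 → ℝ) (u₀ : T3 → V3), Continuous a₀ → Continuous θ₀ → Continuous u₀ →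
    (∀ x, 0 < a₀ x) → (∀ x, 0 < θ₀ x) → ∃ σ₀ : ℝ, 0 < σ₀ ∧ ∀ σ : ℝ, 0 < σ → σ < σ₀ →
    ∀ (T : ℝ) (ρ θ : ℝ → T3 → ℝ) (u : ℝ → T3 → V3), IsHardSphereEulerSolution σ T ρ u θ →
    ∀ Φ : (N : ℕ) → HardSphereFlow (Torus.geometry (Fin 3)) (hsDiameter σ N) (N + 1),
      TendstoHydroFieldsAt (fun N => localGibbsLaw σ a₀ u₀ θ₀ N (Φ N)) Φ ρ u θ 0 →
      ∀ t ∈ Set.Ico 0 T, ∃ Θ₀ : ℝ, 0 < Θ₀ ∧ ∃ B₁ : ℝ, ∃ N₀ : ℕ, ∀ N : ℕ, N₀ ≤ N →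
        ∀ s ∈ Set.Icc 0 t, ∀ (i : Fin (N + 1)) (L : ℕ), 1 ≤ L →
          (localGibbsLaw σ a₀ u₀ θ₀ N (Φ N))
              {z | (L : ℝ) * Θ₀ ≤ warmIntake (hsDiameter σ N) (fun r => (Φ N).flow r z) Θ₀ i s}
            ≤ ENNReal.ofReal (B₁ / (L : ℝ) ^ 5)

/-! ## §4 Glue of the reshaped ledger -/

/-- The reshaped ledger re-assembles: sure part and measurable part give `LineageLedger`
(registered helper `lineageLedger_of`; the only assertion of this file, a definitional `And.intro`). -/
theorem lineageLedger_of : LineageLedgerSure → LineageMeasurable → LineageLedger :=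
  fun hS hM => ⟨hS, hM⟩

end Summit.AtomisticToContinuum.HydrodynamicLimit.Theorems.EnergyCurrentTailsPedigree

end
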